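import Summits.QuantumFields.YangMills.Theorems.BalabanLadderIROnsetBootstrap
import Summits.QuantumFields.YangMills.Theorems.IR.Negative.OnsetUcFalseOfMonopoleWire
import Summits.QuantumFields.YangMills.Theorems.IR.AfPincerUcTypCriterion
import Summits.QuantumFields.YangMills.Theses.CertificationLength
import HarnessLib

/-!
# Crux `IR` (stmt-QuantumFields-19354), line `af-pincer-Uc`: crux stmt-QuantumFields-16178
# `CertificationLength.CompleteAnalyticityAtLargeScales` CLOSES the registered stub `stub_onsetUc` (kernel-checked dedup)

Helper module for item `stmt-QuantumFields-19354` (`--supports`; it closes nothing — both sides are open statements);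
lead prover of the line.  Route-tied on purpose: it imports the statement of crux 16178 (`Theses/CertificationLength`) and
the slot's format module (`Theorems/IR/AfPincerUcFormat`, for `AfPincerUc.OnsetMixingTypicalUKPc` = the type of `stub_onsetUc`).

* `onsetMixing_of_completeAnalyticityAtLargeScales : CompleteAnalyticityAtLargeScales → OnsetFormats.OnsetMixing` — 16178's
  per-frame finite-size condition (exterior pairs agreeing on the whole window) gives the universal shell condition
  (`AfPincerUc.Calibration.univShellCond_of_windowAgreement`: the kernel never reads its datum on the links it resamples),
  with the same `(n, ε)`, `ε · shellCount n < 1`, at `B = 1`.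
* **`onsetMixingTypicalUKPc_of_completeAnalyticityAtLargeScales :
  CompleteAnalyticityAtLargeScales → AfPincerUc.OnsetMixingTypicalUKPc`** — through the Dobrushin–Shlosman bootstrap
  `AfPincerUc.Bootstrap.onsetMixingTypicalUKPc_of_onsetMixing` (threshold `< 1` ⇒ the engine's `≤ 3/4` at a larger window)
  and S1's bridge `AfPincerUc.onsetMixingTypicalUKPc_iff_mirror`.  So a proof of crux 16178 closes `stub_onsetUc` BY NAME
  (`stub_onsetUc := onsetMixingTypicalUKPc_of_completeAnalyticityAtLargeScales h16178`); the line card's DEDUP remark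
  («I is implied by 16178», `af-pincer-dedup-CALS.lean` for the g0 stub) now holds in the kernel for the Uc stub.

HONEST FRAMING: an implication between two OPEN statements (complete analyticity of 4-d lattice Yang–Mills at arbitrarily
large scales ⇒ the Uc onset stub); neither is claimed; conditional chain above the crux untouched; not a gap, not Clay.
No `sorry`; axioms ⊆ {propext, Classical.choice, Quot.sound}.
-/

set_option autoImplicit false

noncomputable section

open Literature.MathematicalPhysics.QuantumFieldTheory Literature.MathematicalPhysics.QuantumLattice
open Summit.QuantumFields.YangMills.Cruxes.IR.OnsetFormats (shellCount UnivShellCond OnsetMixing)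
open Summit.QuantumFields.YangMills.Cruxes.IR.AfPincerUc.Calibration (univShellCond_of_windowAgreement)
open Summit.QuantumFields.YangMills.Cruxes.IR.AfPincerUc.Bootstrap (onsetMixingTypicalUKPc_of_onsetMixing)
open Summit.QuantumFields.YangMills.Theses.CertificationLength (CompleteAnalyticityAtLargeScales)

namespace Summit.QuantumFields.YangMills.Cruxes.IR.AfPincerUc.Bootstrap

/-- **Crux 16178 ⇒ the universal onset statement** `OnsetFormats.OnsetMixing` (slot g0's stub I): same `(n, ε)` with
`ε · shellCount n < 1`; at every `β ≥ β₂(1)` the certifying mesh `b ≥ 1` of 16178 is a universal mixing mesh, because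
window-agreement mixing implies the universal shell condition (`univShellCond_of_windowAgreement`). -/
theorem onsetMixing_of_completeAnalyticityAtLargeScales (h : CompleteAnalyticityAtLargeScales) : OnsetMixing := by
  intro G _ _ _ _ hG
  letI : MeasurableSpace G := borel G
  haveI : BorelSpace G := ⟨rfl⟩
  intro r
  obtain ⟨n, ε, hn, hε, hlt, hB⟩ := h G hG r
  obtain ⟨β₂, hβ⟩ := hB 1
  refine ⟨n, ε, hn, hε, hlt, β₂, fun β hb => ?_⟩
  obtain ⟨b, _, hb1, hFS⟩ := hβ β hb
  exact ⟨b, hb1, univShellCond_of_windowAgreement r.ρ fun w hw Y hY h0 σ σ' hag f hf hfm hf01 =>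
    hFS w hw Y hY h0 σ σ' hag f hf hfm hf01⟩

/-- **Crux 16178 closes `stub_onsetUc`: `CompleteAnalyticityAtLargeScales → AfPincerUc.OnsetMixingTypicalUKPc`.** -/
theorem onsetMixingTypicalUKPc_of_completeAnalyticityAtLargeScales (h : CompleteAnalyticityAtLargeScales) :
    Summit.QuantumFields.YangMills.Cruxes.IR.AfPincerUc.OnsetMixingTypicalUKPc :=
  onsetMixingTypicalUKPc_iff_mirror.mpr
    (onsetMixingTypicalUKPc_of_onsetMixing (onsetMixing_of_completeAnalyticityAtLargeScales h))

/-! ## After the «SC ∕ NSC split» (owner R89, slot d9d9d710e4ae01bd; appended 2026-08-27) -/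

/-- **Crux 16178 closes the RESHAPED stub `stub_onsetUcSC : OnsetFormatsUc.OnsetMixingTypicalUKPcSC`** (the old statement with
the hypothesis `SimplyConnectedSpace G`; disprover's repair C′, `onsetMixingTypicalUKPcSC_of_UKPc`). -/
theorem onsetMixingTypicalUKPcSC_of_completeAnalyticityAtLargeScales (h : CompleteAnalyticityAtLargeScales) :
    OnsetFormatsUc.OnsetMixingTypicalUKPcSC :=
  OnsetFormatsUc.onsetMixingTypicalUKPcSC_of_UKPc
    (onsetMixingTypicalUKPc_of_onsetMixing (onsetMixing_of_completeAnalyticityAtLargeScales h))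

/-- **By-product for route `CertificationLength`: the monopole wire kills crux 16178 as typed.**  `CompleteAnalyticityAtLargeScales`
quantifies over ALL compact simple `G`; through `onsetMixing_of_completeAnalyticityAtLargeScales` and the bootstrap it implies the
(old, all-`G`) onset statement `OnsetMixingTypicalUKPc`, which the disprover's `MonopoleWire` refutes on the non-simply-connected
family (`OnsetFormatsUc.not_onsetMixingTypicalUKPc_of_monopoleWire`, p521601).  Hence `MonopoleWire → ¬ CompleteAnalyticityAtLargeScales`
— the same physics-grade misstatement diagnosis (forced `π₁`-defects at every scale) applies to 16178; its repair is the same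
hypothesis `SimplyConnectedSpace G`.  (`MonopoleWire` is a hypothesis, not constructed in the tree: this is a negative MODULO it.) -/
theorem not_completeAnalyticityAtLargeScales_of_monopoleWire (hW : OnsetFormatsUc.MonopoleWire) :
    ¬ CompleteAnalyticityAtLargeScales := fun h =>
  OnsetFormatsUc.not_onsetMixingTypicalUKPc_of_monopoleWire hW
    (onsetMixingTypicalUKPc_of_onsetMixing (onsetMixing_of_completeAnalyticityAtLargeScales h))

/-! ## The line's conditional closure of the crux through crux 16178 (E^{Uc} discharged by S1's p524017; appended 2026-08-27) -/

/-- **`BalabanLadder.IR ⇐ CompleteAnalyticityAtLargeScales ∧ AFToOnsetUKPc` (kernel-checked, credits nothing — BOTH antecedents are OPEN).**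
With the engine stub landed BY NAME (`AfPincerUc.stub_typCriterionUc : TypCriterionUKPc`, `Theorems/IR/AfPincerUcTypCriterion`, stub
prover S1, p524017) and the dedup edge above, the slot's own composition `ir_of_pincerUc` turns crux stmt-QuantumFields-16178 plus the
X-stub's statement into the ROUTE DECL `Summit.QuantumFields.YangMills.Theses.BalabanLadder.IR`.  Reading (owner R90∕R91): on the simply
connected family this is «IR ⇐ 16178|_{SC} ∧ X^{Uc}»; on the non-simply-connected family both 16178 and the old onset statement are
monopole-misstated (`not_completeAnalyticityAtLargeScales_of_monopoleWire`), so the honest residual there is the slot's `stub_irNSC`.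
This theorem is an implication between open statements, displayed `proof.conditional`; it closes nothing. -/
theorem ir_of_completeAnalyticityAtLargeScales_afOnset (hC : CompleteAnalyticityAtLargeScales)
    (hX : Summit.QuantumFields.YangMills.Cruxes.IR.AfPincerUc.AFToOnsetUKPc) :
    Summit.QuantumFields.YangMills.Theses.BalabanLadder.IR :=
  ir_of_pincerUc stub_typCriterionUc (onsetMixingTypicalUKPc_of_completeAnalyticityAtLargeScales hC) hX

end Summit.QuantumFields.YangMills.Cruxes.IR.AfPincerUc.Bootstrap

end
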